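import Literature.AlgebraicTopology.SingularHomology.IncidenceConstancy
import Literature.AlgebraicTopology.SingularHomology.OrientationReversingHomeomorph
import Mathlib.Analysis.InnerProductSpace.Projection.FiniteDimensional
import HarnessLib

/-!
# Precomposing a Euclidean chart with a reflection reverses the sign it induces on an orientation

Topic `Literature/AlgebraicTopology/SingularHomology`.  Generic local-homology bookkeeping for
the sign comparison of the two dockings in Milnor's proof of the basis theorem (*Lectures on the
h-cobordism theorem* (1965), Thm. 7.6 with Lemma 7.7, PDF pp. 50–52: the frame `μ(b)` of
Lemma 7.7 is chosen so that the intersection number comes out `+1`; replacing the frame by its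
mirror image changes the sign).  In the tree the two slid discs are compared on a common open
piece `O` of both, oriented by `μ`, into which a Euclidean open set `𝒱 ⊆ ℝᵏ` is embedded by two
charts `ê₀`, `ê₁` with `ê₁ = ê₀ ∘ R` for a linear map `R` of negative determinant:

* `HomologicalOrientation.map_localClass_eq_neg_of_det_neg` — a continuous linear automorphism
  `R` of `ℝᵏ` with `det R < 0` reverses every `ℤ`-orientation `g` of `ℝᵏ`: `R⁎ g_p = -g_{R p}`
  (Hatcher 2002, §2.2 Exercise 7 / §3.3 p. 233: reflections reverse local orientations; here from
  `HomologicalOrientation.comap_eq_neg_of_hasFDerivAt` at the fixed point `0`), and its version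
  on an `R`-invariant open set `𝒱` (`map_restrict_openSubsetIso_inv_localClass_of_det_neg`);
* `map_subsetInclusion_openSubsetIso_inv`, `map_map_subsetIncl_xEquiv_eq` — restriction of a
  local class of `ℝᵏ` to nested open sets, and naturality of the cross-universe transport of a
  local class along two compatible charts (`relativeSingularHomology.xEquiv_map`);
* `units_eq_neg_of_localClass_eq_smul_of_det_neg` — **the flip**: if `μ` reads `d₀ • g` in
  the chart `ê₀` and `d₁ • g` in the chart `ê₁ = ê₀ ∘ R`, then `d₁ = -d₀`;
* `exists_linearIsometryEquiv_det_eq_neg_one` — `ℝᵐ`, `m ≥ 1`, has a linear isometry of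
  determinant `-1` (a hyperplane reflection, `Submodule.det_reflection`).

Everything here is proved; no definitions, no named facts.

## References

* A. Hatcher, *Algebraic Topology*, CUP 2002, §2.2 Exercise 7, Thm. 2.20, §3.3 pp. 231–236.
  [HatcherAT2002]
* J. Milnor, *Lectures on the h-cobordism theorem*, Princeton Mathematical Notes (1965),
  Lemma 7.7 and proof of Thm. 7.6 (PDF pp. 50–52).  Held:
  `lit read book:milnornd-lectures-h-cobordism-theorem`. [MilnorHCobordism1965]
-/

open CategoryTheory Set Function Filter Topology

universe u

noncomputable section

namespace Literature.AlgebraicTopology.SingularHomology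

/-! ### A linear map of negative determinant reverses every orientation of `ℝᵏ` -/

/-- **A continuous linear automorphism of `ℝᵏ` of negative determinant reverses every
`ℤ`-orientation of `ℝᵏ`**: `R⁎ g_p = -g_{R p}` (Hatcher 2002, §2.2 Exercise 7; here: `R` fixes
`0`, where it is its own derivative in the identity chart, so `g.comap R = -g` by
`HomologicalOrientation.comap_eq_neg_of_hasFDerivAt`, `ℝᵏ` being connected).
[cite: HatcherAT2002, §2.2 Exercise 7, §3.3 p. 233] -/
theorem HomologicalOrientation.map_localClass_eq_neg_of_det_neg {k : ℕ}
    (g : HomologicalOrientation ℤ (EuclideanSpace ℝ (Fin k)) k)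
    (R : EuclideanSpace ℝ (Fin k) ≃L[ℝ] EuclideanSpace ℝ (Fin k))
    (hdet : LinearMap.det ((R : EuclideanSpace ℝ (Fin k) →L[ℝ] EuclideanSpace ℝ (Fin k)) :
      EuclideanSpace ℝ (Fin k) →ₗ[ℝ] EuclideanSpace ℝ (Fin k)) < 0)
    (p q : EuclideanSpace ℝ (Fin k)) (hq : R p = q) :
    relativeSingularHomology.map ℤ ℤ (R.toHomeomorph : C(EuclideanSpace ℝ (Fin k), EuclideanSpace ℝ (Fin k)))
        (mapsTo_compl_singleton_of_injective R.injective hq) k (g.localClass p) = -g.localClass q := by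
  subst hq
  have hA : HasFDerivAt (fun v => (OpenPartialHomeomorph.refl (EuclideanSpace ℝ (Fin k)))
      (R.toHomeomorph ((OpenPartialHomeomorph.refl (EuclideanSpace ℝ (Fin k))).symm v)))
      (R : EuclideanSpace ℝ (Fin k) →L[ℝ] EuclideanSpace ℝ (Fin k))
      ((OpenPartialHomeomorph.refl (EuclideanSpace ℝ (Fin k))) 0) :=
    (R : EuclideanSpace ℝ (Fin k) →L[ℝ] EuclideanSpace ℝ (Fin k)).hasFDerivAt
  have hcomap := HomologicalOrientation.comap_eq_neg_of_hasFDerivAt g R.toHomeomorph (y := 0)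
    (by rw [ContinuousLinearEquiv.coe_toHomeomorph, map_zero]) (OpenPartialHomeomorph.refl _)
    (mem_univ _) hA hdet
  have h1 := congrArg (fun ν : HomologicalOrientation ℤ (EuclideanSpace ℝ (Fin k)) k => ν.localClass p) hcomap
  simp only [HomologicalOrientation.comap_localClass, HomologicalOrientation.neg_localClass] at h1
  have h2 := congrArg (localHomology.mapIso ℤ ℤ R.toHomeomorph p k).hom h1
  rw [Iso.inv_hom_id_apply, map_neg] at h2
  change (localHomology.mapIso ℤ ℤ R.toHomeomorph p k).hom (g.localClass p) = -g.localClass (R.toHomeomorph p)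
  rw [h2, neg_neg]

/-- The restriction `v ↦ R v` of a continuous linear automorphism `R` of `ℝᵏ` to an
`R`-invariant subset is injective. [folklore] -/
theorem restrict_injective_of_mapsTo {k : ℕ} (R : EuclideanSpace ℝ (Fin k) ≃L[ℝ] EuclideanSpace ℝ (Fin k))
    {𝒱 : Set (EuclideanSpace ℝ (Fin k))} (hR : MapsTo R 𝒱 𝒱) :
    Injective (fun v : ↥𝒱 => (⟨R v, hR v.2⟩ : ↥𝒱)) :=
  fun _ _ h => Subtype.ext (R.injective (congrArg Subtype.val h))

/-- **Restricting a local class of `ℝᵏ` to nested open sets**: for `𝒱 ⊆ V` open and `c ∈ 𝒱`,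
the inclusion `𝒱 ⊆ V` sends `g_c|_𝒱` to `g_c|_V` (both excision preimages of the same class
of `Hₖ(ℝᵏ | c)`). [cite: HatcherAT2002, Thm. 2.20] -/
theorem map_subsetInclusion_openSubsetIso_inv {k : ℕ} {𝒱 V : Set (EuclideanSpace ℝ (Fin k))}
    (h𝒱 : IsOpen 𝒱) (hV : IsOpen V) (h : 𝒱 ⊆ V) (c : ↥𝒱)
    (m : localHomology ℤ ℤ (EuclideanSpace ℝ (Fin k)) (c : EuclideanSpace ℝ (Fin k)) k) :
    relativeSingularHomology.map ℤ ℤ (subsetInclusion h)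
        (mapsTo_compl_singleton_of_injective (inclusion_injective h) rfl) k
        ((localHomology.openSubsetIso ℤ ℤ h𝒱 c.2 k).inv m) =
      (localHomology.openSubsetIso ℤ ℤ hV (h c.2) k).inv m := by
  have hinj : Injective (localHomology.openSubsetIso ℤ ℤ hV (h c.2) k).hom :=
    (ModuleCat.mono_iff_injective _).1 inferInstance
  apply hinj
  have hcomp : (subsetIncl V).comp (subsetInclusion h) = subsetIncl 𝒱 := by ext v; rfl
  change ((localHomology.openSubsetIso ℤ ℤ h𝒱 c.2 k).inv ≫
      relativeSingularHomology.map ℤ ℤ (subsetInclusion h)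
        (mapsTo_compl_singleton_of_injective (inclusion_injective h) rfl) k ≫
      relativeSingularHomology.map ℤ ℤ (subsetIncl V) (localHomology.mapsTo_subsetIncl_compl (h c.2)) k) m =
    ((localHomology.openSubsetIso ℤ ℤ hV (h c.2) k).inv ≫ (localHomology.openSubsetIso ℤ ℤ hV (h c.2) k).hom) m
  rw [← relativeSingularHomology.map_comp,
    relativeSingularHomology.map_congr ℤ ℤ hcomp _ (localHomology.mapsTo_subsetIncl_compl c.2) k,
    Iso.inv_hom_id, ModuleCat.id_apply]
  change ((localHomology.openSubsetIso ℤ ℤ h𝒱 c.2 k).inv ≫ (localHomology.openSubsetIso ℤ ℤ h𝒱 c.2 k).hom) m = m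
  rw [Iso.inv_hom_id, ModuleCat.id_apply]

/-- **On an `R`-invariant open set the restriction of `R` reverses the restricted orientation
classes**: `(R|_𝒱)⁎ (g_c|_𝒱) = -(g_{R c}|_𝒱)` for `det R < 0`. [cite: HatcherAT2002, §2.2 Exercise 7, Thm. 2.20] -/
theorem map_restrict_openSubsetIso_inv_localClass_of_det_neg {k : ℕ}
    (g : HomologicalOrientation ℤ (EuclideanSpace ℝ (Fin k)) k)
    (R : EuclideanSpace ℝ (Fin k) ≃L[ℝ] EuclideanSpace ℝ (Fin k))
    (hdet : LinearMap.det ((R : EuclideanSpace ℝ (Fin k) →L[ℝ] EuclideanSpace ℝ (Fin k)) :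
      EuclideanSpace ℝ (Fin k) →ₗ[ℝ] EuclideanSpace ℝ (Fin k)) < 0)
    {𝒱 : Set (EuclideanSpace ℝ (Fin k))} (h𝒱 : IsOpen 𝒱) (hR : MapsTo R 𝒱 𝒱) (c : ↥𝒱) :
    relativeSingularHomology.map ℤ ℤ
        (⟨fun v : ↥𝒱 => (⟨R v, hR v.2⟩ : ↥𝒱), (R.continuous.comp continuous_subtype_val).subtype_mk _⟩ : C(↥𝒱, ↥𝒱))
        (mapsTo_compl_singleton_of_injective (restrict_injective_of_mapsTo R hR) rfl) k
        ((localHomology.openSubsetIso ℤ ℤ h𝒱 c.2 k).inv (g.localClass (c : EuclideanSpace ℝ (Fin k)))) =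
      -(localHomology.openSubsetIso ℤ ℤ h𝒱 (hR c.2) k).inv (g.localClass (R c)) := by
  have hinj : Injective (localHomology.openSubsetIso ℤ ℤ h𝒱 (hR c.2) k).hom :=
    (ModuleCat.mono_iff_injective _).1 inferInstance
  apply hinj
  have hcomp : (subsetIncl 𝒱).comp (⟨fun v : ↥𝒱 => (⟨R v, hR v.2⟩ : ↥𝒱), (R.continuous.comp continuous_subtype_val).subtype_mk _⟩ : C(↥𝒱, ↥𝒱)) =
      (R.toHomeomorph : C(EuclideanSpace ℝ (Fin k), EuclideanSpace ℝ (Fin k))).comp (subsetIncl 𝒱) := by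
    ext v; rfl
  rw [map_neg]
  change ((localHomology.openSubsetIso ℤ ℤ h𝒱 c.2 k).inv ≫
      relativeSingularHomology.map ℤ ℤ
        (⟨fun v : ↥𝒱 => (⟨R v, hR v.2⟩ : ↥𝒱), (R.continuous.comp continuous_subtype_val).subtype_mk _⟩ : C(↥𝒱, ↥𝒱))
        (mapsTo_compl_singleton_of_injective (restrict_injective_of_mapsTo R hR) rfl) k ≫
      relativeSingularHomology.map ℤ ℤ (subsetIncl 𝒱) (localHomology.mapsTo_subsetIncl_compl (hR c.2)) k)
        (g.localClass (c : EuclideanSpace ℝ (Fin k))) =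
    -((localHomology.openSubsetIso ℤ ℤ h𝒱 (hR c.2) k).inv ≫ (localHomology.openSubsetIso ℤ ℤ h𝒱 (hR c.2) k).hom)
      (g.localClass (R c))
  rw [← relativeSingularHomology.map_comp,
    relativeSingularHomology.map_congr ℤ ℤ hcomp _
      ((mapsTo_compl_singleton_of_injective R.injective rfl).comp (localHomology.mapsTo_subsetIncl_compl c.2)) k,
    relativeSingularHomology.map_comp, Iso.inv_hom_id, ModuleCat.id_apply]
  change relativeSingularHomology.map ℤ ℤ (R.toHomeomorph : C(EuclideanSpace ℝ (Fin k), EuclideanSpace ℝ (Fin k)))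
      (mapsTo_compl_singleton_of_injective R.injective rfl) k
      (((localHomology.openSubsetIso ℤ ℤ h𝒱 c.2 k).inv ≫ (localHomology.openSubsetIso ℤ ℤ h𝒱 c.2 k).hom)
        (g.localClass (c : EuclideanSpace ℝ (Fin k)))) = -g.localClass (R c)
  rw [Iso.inv_hom_id, ModuleCat.id_apply]
  exact g.map_localClass_eq_neg_of_det_neg R hdet _ _ rfl

/-! ### Transport of a local class along two compatible charts -/

/-- **Naturality of the chart transport of a local class.**  Let `e : V_k ≃ U ⊆ T` and
`ê : 𝒱 ≃ W ⊆ O` be Euclidean charts (`𝒱 ⊆ V_k ⊆ ℝᵏ` open) and `ι : O → T` injective with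
`ι ∘ ê = e` on `𝒱`.  Then for a class `m ∈ Hₖ(ℝᵏ | c)`, `c ∈ 𝒱`, pushing `ê⁎ (m|_𝒱)` into `O`
and then along `ι` gives the push of `e⁎ (m|_{V_k})` into `T`
(`relativeSingularHomology.xEquiv_map`). [cite: HatcherAT2002, §2.1 (naturality), Thm. 2.20] -/
theorem map_map_subsetIncl_xEquiv_eq {k : ℕ} {T : Type u} [TopologicalSpace T]
    {Vk : Set (EuclideanSpace ℝ (Fin k))} {U : Set T} (hVk : IsOpen Vk) (e : ↥Vk ≃ₜ ↥U)
    {O : Type u} [TopologicalSpace O] (ι : C(O, T)) (hι : Injective ι)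
    {𝒱 : Set (EuclideanSpace ℝ (Fin k))} (h𝒱 : IsOpen 𝒱) (h𝒱V : 𝒱 ⊆ Vk)
    {W : Set O} (ê : ↥𝒱 ≃ₜ ↥W)
    (hcomm : ∀ v : ↥𝒱, ι (ê v : O) = (e (Set.inclusion h𝒱V v) : T))
    (c : ↥𝒱) (m : localHomology ℤ ℤ (EuclideanSpace ℝ (Fin k)) (c : EuclideanSpace ℝ (Fin k)) k) :
    relativeSingularHomology.map ℤ ℤ ι (mapsTo_compl_singleton_of_injective hι (hcomm c)) k
        (relativeSingularHomology.map ℤ ℤ (subsetIncl W) (localHomology.mapsTo_subsetIncl_compl (ê c).2) k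
          (localHomology.xEquiv ℤ ℤ ê c k ((localHomology.openSubsetIso ℤ ℤ h𝒱 c.2 k).inv m))) =
      relativeSingularHomology.map ℤ ℤ (subsetIncl U)
        (localHomology.mapsTo_subsetIncl_compl (e (Set.inclusion h𝒱V c)).2) k
        (localHomology.xEquiv ℤ ℤ e (Set.inclusion h𝒱V c) k
          ((localHomology.openSubsetIso ℤ ℤ hVk (h𝒱V c.2) k).inv m)) := by
  -- the map `W → U`, `w ↦ ι w`
  have hWU : ∀ w : ↥W, ι (w : O) ∈ U := fun w => by
    obtain ⟨v, rfl⟩ := ê.surjective w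
    rw [hcomm v]; exact (e _).2
  set gWU : C(↥W, ↥U) := ⟨fun w => ⟨ι w, hWU w⟩, by fun_prop⟩ with hgWU
  have hsq : ∀ v : ↥𝒱, gWU (ê v) = e (Set.inclusion h𝒱V v) := fun v => Subtype.ext (hcomm v)
  have hf : MapsTo (subsetInclusion h𝒱V) ({c}ᶜ : Set ↥𝒱) ({Set.inclusion h𝒱V c}ᶜ : Set ↥Vk) :=
    mapsTo_compl_singleton_of_injective (inclusion_injective h𝒱V) rfl
  have hginj : Injective gWU := fun w w' h => Subtype.ext (hι (congrArg Subtype.val h))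
  have hg : MapsTo gWU ({ê c}ᶜ : Set ↥W) ({e (Set.inclusion h𝒱V c)}ᶜ : Set ↥U) :=
    mapsTo_compl_singleton_of_injective hginj (hsq c)
  have hnat := relativeSingularHomology.xEquiv_map ℤ ℤ ê e (subsetInclusion h𝒱V) gWU hsq
    (mapsTo_compl_singleton ê.toEquiv c) (mapsTo_symm_compl_singleton ê.toEquiv c)
    (mapsTo_compl_singleton e.toEquiv (Set.inclusion h𝒱V c))
    (mapsTo_symm_compl_singleton e.toEquiv (Set.inclusion h𝒱V c)) hf hg k
    ((localHomology.openSubsetIso ℤ ℤ h𝒱 c.2 k).inv m)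
  -- rewrite the right-hand side through `𝒱`
  rw [← map_subsetInclusion_openSubsetIso_inv h𝒱 hVk h𝒱V c m]
  change _ = relativeSingularHomology.map ℤ ℤ (subsetIncl U) _ k
    (relativeSingularHomology.xEquiv ℤ ℤ e _ _ k (relativeSingularHomology.map ℤ ℤ (subsetInclusion h𝒱V) hf k
      ((localHomology.openSubsetIso ℤ ℤ h𝒱 c.2 k).inv m)))
  rw [hnat]
  -- both sides are push-forwards along `ι ∘ (W ⊆ O) = (U ⊆ T) ∘ gWU`
  have hcomp : ι.comp (subsetIncl W) = (subsetIncl U).comp gWU := by ext w; rfl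
  rw [← ModuleCat.comp_apply, ← relativeSingularHomology.map_comp, ← ModuleCat.comp_apply,
    ← relativeSingularHomology.map_comp,
    relativeSingularHomology.map_congr ℤ ℤ hcomp _ ((localHomology.mapsTo_subsetIncl_compl _).comp hg) k]
  rfl

/-! ### The flip -/

/-- Transport of an orientation class along an equality of base points. [folklore] -/
theorem HomologicalOrientation.map_id_localClass_of_eq {k : ℕ} {O : Type u} [TopologicalSpace O]
    (μ : HomologicalOrientation ℤ O k) {p q : O} (hpq : p = q)
    (hid : MapsTo (ContinuousMap.id O) ({p}ᶜ : Set O) ({q}ᶜ : Set O)) :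
    relativeSingularHomology.map ℤ ℤ (ContinuousMap.id O) hid k (μ.localClass p) = μ.localClass q := by
  subst hpq
  rw [relativeSingularHomology.map_congr ℤ ℤ rfl hid (mapsTo_id _) k, relativeSingularHomology.map_id,
    ModuleCat.id_apply]

/-- **The flip: precomposing the chart with a map of negative determinant reverses the sign it
induces.**  Let `μ` be a `ℤ`-orientation of `O`, `g` one of `ℝᵏ`, `𝒱 ⊆ ℝᵏ` open and invariant
under a continuous linear automorphism `R` with `det R < 0`, and `ê₀ : 𝒱 ≃ W₀`, `ê₁ : 𝒱 ≃ W₁`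
charts into `O` with `ê₁ = ê₀ ∘ R`.  If `μ = d₀ • (ê₀)⁎ g` along `ê₀` and `μ = d₁ • (ê₁)⁎ g`
along `ê₁` (units `d₀`, `d₁`), then `d₁ = -d₀` (Milnor 1965, Lemma 7.7 / PDF p. 52: mirroring
the frame of the docking changes the sign of the intersection number).
[cite: MilnorHCobordism1965, Lemma 7.7 and proof of Thm. 7.6 (PDF pp. 51–52); HatcherAT2002, §2.2 Exercise 7, §3.3 p. 233] -/
theorem units_eq_neg_of_localClass_eq_smul_of_det_neg {k : ℕ} {O : Type u} [TopologicalSpace O]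
    (μ : HomologicalOrientation ℤ O k) (g : HomologicalOrientation ℤ (EuclideanSpace ℝ (Fin k)) k)
    {𝒱 : Set (EuclideanSpace ℝ (Fin k))} (h𝒱 : IsOpen 𝒱)
    (R : EuclideanSpace ℝ (Fin k) ≃L[ℝ] EuclideanSpace ℝ (Fin k))
    (hdet : LinearMap.det ((R : EuclideanSpace ℝ (Fin k) →L[ℝ] EuclideanSpace ℝ (Fin k)) :
      EuclideanSpace ℝ (Fin k) →ₗ[ℝ] EuclideanSpace ℝ (Fin k)) < 0)
    (hR : MapsTo R 𝒱 𝒱) {W₀ W₁ : Set O} (ê₀ : ↥𝒱 ≃ₜ ↥W₀) (ê₁ : ↥𝒱 ≃ₜ ↥W₁)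
    (hê : ∀ v : ↥𝒱, (ê₁ v : O) = (ê₀ ⟨R v, hR v.2⟩ : O)) {d₀ d₁ : ℤˣ}
    (h₀ : ∀ c : ↥𝒱, μ.localClass (ê₀ c : O) =
      (d₀ : ℤ) • relativeSingularHomology.map ℤ ℤ (subsetIncl W₀)
        (localHomology.mapsTo_subsetIncl_compl (ê₀ c).2) k
        (localHomology.xEquiv ℤ ℤ ê₀ c k
          ((localHomology.openSubsetIso ℤ ℤ h𝒱 c.2 k).inv (g.localClass (c : EuclideanSpace ℝ (Fin k))))))
    (h₁ : ∀ c : ↥𝒱, μ.localClass (ê₁ c : O) =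
      (d₁ : ℤ) • relativeSingularHomology.map ℤ ℤ (subsetIncl W₁)
        (localHomology.mapsTo_subsetIncl_compl (ê₁ c).2) k
        (localHomology.xEquiv ℤ ℤ ê₁ c k
          ((localHomology.openSubsetIso ℤ ℤ h𝒱 c.2 k).inv (g.localClass (c : EuclideanSpace ℝ (Fin k))))))
    (c : ↥𝒱) : d₁ = -d₀ := by
  set c' : ↥𝒱 := ⟨R c, hR c.2⟩ with hc'
  set Rh : C(↥𝒱, ↥𝒱) := (⟨fun v : ↥𝒱 => (⟨R v, hR v.2⟩ : ↥𝒱), (R.continuous.comp continuous_subtype_val).subtype_mk _⟩ : C(↥𝒱, ↥𝒱)) with hRh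
  -- the inclusion `W₁ → W₀`
  have hW : ∀ w : ↥W₁, (w : O) ∈ W₀ := fun w => by
    obtain ⟨v, rfl⟩ := ê₁.surjective w
    rw [hê v]; exact (ê₀ _).2
  set ginc : C(↥W₁, ↥W₀) := ⟨fun w => ⟨w, hW w⟩, by fun_prop⟩ with hginc
  have hsq : ∀ v : ↥𝒱, ginc (ê₁ v) = ê₀ (Rh v) := fun v => Subtype.ext (hê v)
  have hf : MapsTo Rh ({c}ᶜ : Set ↥𝒱) ({c'}ᶜ : Set ↥𝒱) :=
    mapsTo_compl_singleton_of_injective (restrict_injective_of_mapsTo R hR) rfl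
  have hginj : Injective ginc := fun w w' h => by
    have h' : ((ginc w : ↥W₀) : O) = ((ginc w' : ↥W₀) : O) := congrArg Subtype.val h
    exact Subtype.ext h'
  have hg : MapsTo ginc ({ê₁ c}ᶜ : Set ↥W₁) ({ê₀ c'}ᶜ : Set ↥W₀) :=
    mapsTo_compl_singleton_of_injective hginj (hsq c)
  set m : localHomology ℤ ℤ ↥𝒱 c k :=
    (localHomology.openSubsetIso ℤ ℤ h𝒱 c.2 k).inv (g.localClass (c : EuclideanSpace ℝ (Fin k))) with hm
  set m' : localHomology ℤ ℤ ↥𝒱 c' k :=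
    (localHomology.openSubsetIso ℤ ℤ h𝒱 c'.2 k).inv (g.localClass (c' : EuclideanSpace ℝ (Fin k))) with hm'
  -- naturality and the reflection
  have hnat := relativeSingularHomology.xEquiv_map ℤ ℤ ê₁ ê₀ Rh ginc hsq
    (mapsTo_compl_singleton ê₁.toEquiv c) (mapsTo_symm_compl_singleton ê₁.toEquiv c)
    (mapsTo_compl_singleton ê₀.toEquiv c') (mapsTo_symm_compl_singleton ê₀.toEquiv c') hf hg k m
  have hrefl : relativeSingularHomology.map ℤ ℤ Rh hf k m = -m' :=
    map_restrict_openSubsetIso_inv_localClass_of_det_neg g R hdet h𝒱 hR c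
  -- transport `h₁ c` to the base point `ê₀ c'`
  have hpt : ((ê₁ c : ↥W₁) : O) = ((ê₀ c' : ↥W₀) : O) := hê c
  have hid : MapsTo (ContinuousMap.id O) ({((ê₁ c : ↥W₁) : O)}ᶜ : Set O) ({((ê₀ c' : ↥W₀) : O)}ᶜ : Set O) := by
    rw [hpt]; exact mapsTo_id _
  have hT := congrArg (relativeSingularHomology.map ℤ ℤ (ContinuousMap.id O) hid k) (h₁ c)
  rw [μ.map_id_localClass_of_eq hpt hid, map_zsmul] at hT
  have hcomp : (ContinuousMap.id O).comp (subsetIncl W₁) = (subsetIncl W₀).comp ginc := by ext w; rfl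
  rw [← ModuleCat.comp_apply, ← relativeSingularHomology.map_comp,
    relativeSingularHomology.map_congr ℤ ℤ hcomp _ ((localHomology.mapsTo_subsetIncl_compl (ê₀ c').2).comp hg) k,
    relativeSingularHomology.map_comp, ModuleCat.comp_apply] at hT
  change μ.localClass ((ê₀ c' : ↥W₀) : O) = (d₁ : ℤ) • relativeSingularHomology.map ℤ ℤ (subsetIncl W₀)
      (localHomology.mapsTo_subsetIncl_compl (ê₀ c').2) k
      (relativeSingularHomology.map ℤ ℤ ginc hg k (localHomology.xEquiv ℤ ℤ ê₁ c k m)) at hT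
  have hT' : μ.localClass ((ê₀ c' : ↥W₀) : O) = -((d₁ : ℤ) • relativeSingularHomology.map ℤ ℤ (subsetIncl W₀)
      (localHomology.mapsTo_subsetIncl_compl (ê₀ c').2) k (localHomology.xEquiv ℤ ℤ ê₀ c' k m')) := by
    rw [hT]
    change (d₁ : ℤ) • relativeSingularHomology.map ℤ ℤ (subsetIncl W₀) _ k
      (relativeSingularHomology.map ℤ ℤ ginc hg k (relativeSingularHomology.xEquiv ℤ ℤ ê₁ _ _ k m)) = _
    rw [← hnat]
    change (d₁ : ℤ) • relativeSingularHomology.map ℤ ℤ (subsetIncl W₀) _ k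
      (localHomology.xEquiv ℤ ℤ ê₀ c' k (relativeSingularHomology.map ℤ ℤ
        (⟨fun v : ↥𝒱 => (⟨R v, hR v.2⟩ : ↥𝒱), (R.continuous.comp continuous_subtype_val).subtype_mk _⟩ : C(↥𝒱, ↥𝒱)) hf k m)) = _
    rw [hrefl, map_neg, map_neg, zsmul_neg]
  -- compare with `h₀ c'`: `Y = d₀ • μ_q`
  have h0 := h₀ c'
  set Y := relativeSingularHomology.map ℤ ℤ (subsetIncl W₀) (localHomology.mapsTo_subsetIncl_compl (ê₀ c').2) k
    (localHomology.xEquiv ℤ ℤ ê₀ c' k m') with hY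
  have hYμ : Y = (d₀ : ℤ) • μ.localClass ((ê₀ c' : ↥W₀) : O) := by
    rw [h0, ← mul_zsmul, ← Units.val_mul, Int.units_mul_self, Units.val_one, one_zsmul]
  rw [hYμ, ← mul_zsmul, ← neg_zsmul, ← Units.val_mul, ← Units.val_neg] at hT'
  have hT'' : ((1 : ℤˣ) : ℤ) • μ.localClass ((ê₀ c' : ↥W₀) : O) =
      ((-(d₁ * d₀) : ℤˣ) : ℤ) • μ.localClass ((ê₀ c' : ↥W₀) : O) := by
    rw [Units.val_one, one_zsmul]; exact hT'
  have hu := units_eq_of_smul_eq_smul (μ.isGenerator _) hT''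
  -- `1 = -(d₁ * d₀)`
  have h3 : d₀ = -(d₁ * d₀) * d₀ := by rw [← hu, one_mul]
  rw [neg_mul, mul_assoc, Int.units_mul_self, mul_one] at h3
  rw [h3, neg_neg]

/-! ### A linear isometry of `ℝᵐ` of determinant `-1` -/

/-- **`ℝᵐ`, `m ≥ 1`, has a linear isometry of determinant `-1`**: the reflection in the
hyperplane orthogonal to the first basis vector (`Submodule.det_reflection`). [folklore] -/
theorem exists_linearIsometryEquiv_det_eq_neg_one {m : ℕ} (hm : 1 ≤ m) :
    ∃ r : EuclideanSpace ℝ (Fin m) ≃ₗᵢ[ℝ] EuclideanSpace ℝ (Fin m),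
      LinearMap.det (r.toLinearEquiv : EuclideanSpace ℝ (Fin m) →ₗ[ℝ] EuclideanSpace ℝ (Fin m)) = -1 := by
  set v : EuclideanSpace ℝ (Fin m) := EuclideanSpace.single ⟨0, hm⟩ 1 with hv
  have hv0 : v ≠ 0 := by
    intro h
    have := congrArg (fun w : EuclideanSpace ℝ (Fin m) => w ⟨0, hm⟩) h
    simp [hv] at this
  refine ⟨(ℝ ∙ v)ᗮ.reflection, ?_⟩
  rw [Submodule.det_reflection, Submodule.orthogonal_orthogonal, finrank_span_singleton hv0, pow_one]

end Literature.AlgebraicTopology.SingularHomology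

end
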